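import Summits.BirchSwinnertonDyer.BirchSwinnertonDyer.Theses.SignedBaseChange
import Summits.BirchSwinnertonDyer.BirchSwinnertonDyer.Theorems.SignedBaseChangeAnticyclotomicEisensteinDivisibilityS1OfSignedEisensteinLive
import Summits.BirchSwinnertonDyer.BirchSwinnertonDyer.Theorems.SignedBaseChangeAnticyclotomicEisensteinDivisibilityFrameConcordance
import Summits.BirchSwinnertonDyer.Rank1Residual.X11b.UnrSeriesIdealDescent
import Summits.BirchSwinnertonDyer.Rank1Residual.Partition.IrreducibleOverQuadraticField
import Literature.NumberTheory.EllipticCurves.BurungaleCastellaSkinner2025.BDPMainConjecture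
import Literature.NumberTheory.EllipticCurves.UnrIntegersUnits
import Literature.NumberTheory.EllipticCurves.NonEisensteinPrimeOfSurjective
import Literature.NumberTheory.EllipticCurves.PAdicGrossZagierConstantTermProofs
import Literature.NumberTheory.EllipticCurves.HeightConductorBoundsModularityProofs
import Literature.NumberTheory.EllipticCurves.BSDSelmerPConverseSerreProofs
import Literature.NumberTheory.EllipticCurves.YanZhu2026.GreenbergMainTheoremsAnyRoot
import HarnessLib

/-! # `ratlift` — HOW on CELL B from Lei–Zhao 2023 Thm. A (documentation for crux 20728; NOT a skeleton, NOT registered)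

Companion to the skeleton of record `Lines/ratlift.lean` v5.2 (stmt-BirchSwinnertonDyer-20728, crux
`Summit.BirchSwinnertonDyer.BirchSwinnertonDyer.Theses.SignedBaseChange.TwoVariableEulerSystemDivisibility`; 4 stubs, unchanged by this file)
in the style of its `section CellA` (l.225–389) and of `Lines/ratlift_ts1shape.lean`.  This file has NO `sorry`, defines NO proposition, asserts
nothing and registers nothing: the two SHAPES below are section `variable`s displayed as explicit hypotheses of the glue theorems.  No summit
statement, crux or stub is proved here; BSD is not proved.

WHAT IT RECORDS.  The stub `Ratlift.stub_howardIntegralSS` (HOW = the INTEGRAL Euler-system half of the BDP anticyclotomic main conjecture at a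
supersingular prime: a Castella-2018 frame `(Ω_K ≠ 0, Ω_p ∈ R₀ˣ, L)` with `L ∈ char_Λ(X_ac)·R₀⟦T⟧` along every compatible `j : ℤ_p → R₀`,
`X_ac = Castella2018.AcSelmer.XAc (W⁄K) p κ₂ v̄ ∅ γ₂` = strict at `v̄`, relaxed at the `ι`-distinguished `v`) had, in the card of record
`Lines/ratlift.md` v6.8, ONE refereed integral print cell: CELL A = {`N` squarefree} ∩ {`E[p]` ramified at every `ℓ ∣ N`} ∩ {`p ∤ h_K`}
(Castella–Hsu–Kundu–Lee–Liu 2025 Thm. 7.1 / Cor. 7.2, typing want #1).  There is a SECOND refereed integral print cell: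

CELL B (Lei–Zhao 2023, Thm. A = "Theorem 1" of arXiv:2211.04377v3 p0003 L30–L49; Manuscripta Math. 173 (2024) 867–888, doi:10.1007/s00229-023-01485-4): `K ≠ ℚ(i), ℚ(√−3)` imaginary quadratic with `d_K` odd or `8 ∣ d_K`; `N > 3` squarefree with every `ℓ ∣ N`
split in `K`; `f` of weight 2 on `Γ₀(N)` (here `f = f_E`); `p` split in `K`, `p ∤ 6·h_K·N·φ(N)`, `f` non-ordinary at `p` with
`ord_p(a_p) ≥ 1/(p+1)` (vacuous at `a_p = 0`), and `Im(G_ℚ → Aut(T_f)) ⊇ GL₂(ℤ_p)`.  CONCLUSION (integral, no `⊗ ℚ_p`):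
`𝔏(f/K)² ∈ Char_Λ(𝒳_{(∅,0)}(f)) ⊗_Λ Λ^ur` — the integral version of Kobayashi–Ota 2020 Thm. 1.1 (ibid. p0003 L21–L26, which has the same
inclusion after `⊗ ℚ_p` plus the `Λ`-torsion of `𝒳_{(∅,0)}(f)`).  Printed corollary (p0003 L51–L52, Hsieh): `μ(𝔏(f/K)) = μ(𝒳_{(∅,0)}(f)) = 0` on cell B.
DICTIONARY (for the typer; flags in `TYPER-KIT-LZ23-g30.md`): `𝒳_{(∅,0)}` = relaxed at the `ι_p`-distinguished `𝔭`, strict at `𝔭̄`, unramified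
away from `p` (Hatley–Lei local conditions, arXiv:2009.03772 p0007 L38–L61) = the tree's `XAc (W⁄K) p κ 𝔭̄ ∅ γ` pairing used by HOW (strict at the
NAMED prime; `Castella2018/AnticyclotomicSelmer.lean` "v ↔ v̄ convention"), up to the finite-level-unramified vs. strict-over-`K_∞` reading at `w ∤ p`
(flag `LZ23-HL-local-conditions`); `𝔏(f/K)²` = the square-normalised BDP `p`-adic `L`-function = the tree's `IsBDPLFunction` object (Castella 2018
Thm. 3.1; flag `LZ23-normalisation`, immaterial up to `𝓞_{ℂ_p}⟦T⟧ˣ` by cross-period rigidity + the descent used in SHAPE B2's glue);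
LZ's coefficients `𝓞 = ℤ_p[√−p]`, `Λ^ur = Λ ⊗ 𝓞̂^ur`: membership descends to `R₀⟦T⟧` because `R₀[√−p]⟦T⟧` is free over `R₀⟦T⟧` on `{1, √−p}` and
`char_Λ(X_ac)` is principal (flag `LZ23-coefficient-descent`); "image ⊇ GL₂(ℤ_p)" = the house currency of LV19 Thm. 1.4 / `HowardHypotheses.surjective`
("every `ℤ_p`-automorphism of `T_pE` is Galois"), DISCHARGED below from `Surj` + `p ≥ 5` by Serre (`serre_hasSurjectiveModNGaloisRep_pow_holds` +
`ThreeAdicImageOverK.mem_range_galoisRepTate_of_forall_hasSurjectiveModNGaloisRep`); `N > 3` DISCHARGED from modularity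
(`ModularForms.eleven_le_conductorNorm_of_modularity`); `p ∤ 6N·d_K` from `5 ≤ p`, good reduction at `p`, `p` split.

THE GLUE (kernel-checked, no `sorry`): `howardIntegralSS_cellB_of_lz23ThmA` — the text of `stub_howardIntegralSS` with the three cell-B binders
`¬ p ∣ NumberField.classNumber K →`, `Squarefree N →`, `¬ p ∣ Nat.totient N →` inserted after `κ₂.IsAnticyclotomic →` (the position cell A uses) —
from SHAPE B1 (conclusion in HOW's own Castella-2018 frame currency: pure instantiation) and from SHAPE B2 (conclusion in the Castella–Wan frame
currency of cell A's shapes: via BCS25 Prop. 4.2.2 (a Castella-2018 frame exists; displayed hypothesis `h422`, = conjunct (4) of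
`Ratlift.stub_namedFactsSS`), the frame concordance `SignedBaseChangeAcDivFrameConcordance.span_map_eq_of_isCWBDPLFunction_of_isBDPLFunction`
and the descent `X11b.unrSeries_mem_span_singleton_of_map_mem`, exactly as in cell A's glue).  So a Literature typing of Lei–Zhao Thm. A in EITHER
currency makes HOW PURE-CITE on cell B.  CELL MAP of HOW after this file: A ∪ B in refereed integral print (B drops A's "`E[p]` ramified at every
`ℓ ∣ N`" in favour of `p ∤ φ(N)`; both need `N` squarefree and `p ∤ h_K`); RESIDUAL = {`N` not squarefree} ∪ {`p ∣ h_K`} ∪ ({`p ∣ φ(N)`} ∩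
{`E[p]` unramified at some `ℓ ∣ N`}) — there HOW stays CONTENT (PRE: CCSS18 Thm. 5.7 / Lemma 5.5 only).  This corrects `Lines/ratlift.md` v6.8
§F-g28 (B) ("no integral Euler-system half off cell A in print"): Lei–Zhao 2023 is one, missed because that probe searched the citers of CHKLL25 / CW24.
[cite: LeiZhao2023, Thm. A (= Thm. 1.2) and Thm. B (arXiv:2211.04377v3 p0003 L30–L49, p0004)] [cite: KobayashiOta2020, Thm. 1.1 (as restated in LeiZhao2023 p0003 L21–L26)]
[cite: Castella2018, Thm. 3.1, Def. 2.2] [cite: CastellaWan2023, Prop. 2.1, 5.2] [cite: BurungaleCastellaSkinner2025, Prop. 4.2.2]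
[cite: LongoVigni2019, Thm. 1.4 (the image currency)] [cite: SerreAbelianLadic1968, Ch. IV §3.4 Lemma 3] -/

set_option linter.dupNamespace false
set_option autoImplicit false

open scoped Classical
open Summit.BirchSwinnertonDyer.BirchSwinnertonDyer.Theses.SignedBaseChange
open Literature.NumberTheory.EllipticCurves

namespace Summit.BirchSwinnertonDyer.BirchSwinnertonDyer.Cruxes.TwoVariableEulerSystemDivisibility.Ratlift.CellB

section CellB

/- SHAPE B1 (section hypothesis; nothing asserted): Lei–Zhao 2023 Thm. A for `f = f_E` at a supersingular `p ≥ 5` (`a_p = 0`), odd `d_K ≠ −3`,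
conclusion in HOW's currency — a Castella-2018 frame `(Ω_K ≠ 0, Ω_p ∈ R₀ˣ, L)`, `IsBDPLFunction ι 𝔭 κ γ f Ω_K Ω_p L`, and along every structure
map `j : ℤ_p → R₀` compatible with `ℤ_p ⊂ ℂ_p` the INTEGRAL membership `L ∈ char_Λ(X_ac strict at 𝔭̄)·R₀⟦T⟧`.  Binders: byte-parallel to cell A's
`hCor72IntegralEulerHalf` where they coincide; cell-B's own: `3 < N`, `Squarefree N`, the GL₂(ℤ_p)-image in LV19's currency, `Odd d_K`, `d_K ≠ −3`,
`¬ p ∣ h_K`, `¬ p ∣ φ(N)`.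
[cite: LeiZhao2023, Thm. A (arXiv:2211.04377v3 p0003 L30–L49)] [cite: Castella2018, Thm. 3.1, Def. 2.2 (arXiv:1704.06608 p. 9)] -/
variable (hLZ23ThmA :
  ∀ {p : ℕ} [Fact p.Prime] (ι : PadicAlgCl p ≃+* ℂ) (W : WeierstrassCurve ℚ) [W.IsElliptic] [W.IsGloballyMinimal]
    (K : Type) [Field K] [NumberField K] (𝔭 𝔭bar : IsDedekindDomain.HeightOneSpectrum (NumberField.RingOfIntegers K))
    (κ : ZpExtension K p) (γ : Field.absoluteGaloisGroup K) [Fact (κ.IsTopGenerator γ)] {N : ℕ} [NeZero N]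
    {f : CuspForm (CongruenceSubgroup.Gamma0 N) 2} (_ : ModularForms.IsNewformOf W f),
    (N : ℤ) = W.conductorNorm ℤ → 3 < N → Squarefree N → 5 ≤ p → W.HasGoodReductionAtPrime p → W.frobeniusTrace p = 0 →
    (∀ u : Module.End ℤ_[p] (W.tateModule p), IsUnit u → u ∈ Set.range (W.galoisRepTate p)) →
    IsImaginaryQuadratic K → Odd (NumberField.discr K) → NumberField.discr K ≠ -3 →
    ((Ideal.span {(p : ℤ)}).primesOver (NumberField.RingOfIntegers K)).ncard = 2 →
      ((p : ℕ) : NumberField.RingOfIntegers K) ∈ 𝔭.asIdeal →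
      (∀ (w : NumberField.InfinitePlace K) (k : NumberField.RingOfIntegers K), k ∈ 𝔭.asIdeal ↔ ‖ι.symm (w.embedding (k : K))‖ < 1) →
      ((p : ℕ) : NumberField.RingOfIntegers K) ∈ 𝔭bar.asIdeal → 𝔭bar ≠ 𝔭 →
    (∀ ℓ : ℕ, ℓ.Prime → ℓ ∣ N → ((Ideal.span {(ℓ : ℤ)}).primesOver (NumberField.RingOfIntegers K)).ncard = 2) →
    IsCoprime (N : ℤ) (NumberField.discr K) → ¬ p ∣ NumberField.classNumber K → ¬ p ∣ Nat.totient N →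
    κ.IsAnticyclotomic →
    ∃ (ΩK : ℂ) (Ωp : (unrIntegers p)ˣ) (L : UnrSeries p),
      ΩK ≠ 0 ∧
      IsBDPLFunction ι 𝔭 κ γ f ΩK ((Ωp : unrIntegers p) : PadicComplex p) L ∧
      ∀ (j : ℤ_[p] →+* unrIntegers p),
        (∀ x : ℤ_[p], ((j x : unrIntegers p) : PadicComplex p) = algebraMap ℚ_[p] (PadicComplex p) (x : ℚ_[p])) →
        L ∈ (Castella2018.AcSelmer.XAc.charIdeal (W.baseChange K) p κ 𝔭bar ∅ γ).map (PowerSeries.map j))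

/- SHAPE B2 (section hypothesis; nothing asserted): the same theorem with its conclusion in the Castella–Wan frame currency of cell A's shapes —
`IsCWBDPLFunction ι 𝔭 κ γ f d_K Ω_K Ω_p L` and `(L) ⊆ char_Λ(X_ac strict at 𝔭̄)·R₀⟦T⟧` along every compatible `j` (byte-parallel to
`Ratlift.hCor72IntegralEulerHalf` but with cell-B's binders).
[cite: LeiZhao2023, Thm. A (arXiv:2211.04377v3 p0003 L30–L49)] [cite: CastellaWan2023, Prop. 2.1 (MS pp. 5–6), Def. 5.1] -/
variable (hLZ23ThmACW :
  ∀ {p : ℕ} [Fact p.Prime] (ι : PadicAlgCl p ≃+* ℂ) (W : WeierstrassCurve ℚ) [W.IsElliptic] [W.IsGloballyMinimal]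
    (K : Type) [Field K] [NumberField K] (𝔭 𝔭bar : IsDedekindDomain.HeightOneSpectrum (NumberField.RingOfIntegers K))
    (κ : ZpExtension K p) (γ : Field.absoluteGaloisGroup K) [Fact (κ.IsTopGenerator γ)] {N : ℕ} [NeZero N]
    {f : CuspForm (CongruenceSubgroup.Gamma0 N) 2} (_ : ModularForms.IsNewformOf W f),
    (N : ℤ) = W.conductorNorm ℤ → 3 < N → Squarefree N → 5 ≤ p → W.HasGoodReductionAtPrime p → W.frobeniusTrace p = 0 →
    (∀ u : Module.End ℤ_[p] (W.tateModule p), IsUnit u → u ∈ Set.range (W.galoisRepTate p)) →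
    IsImaginaryQuadratic K → Odd (NumberField.discr K) → NumberField.discr K ≠ -3 →
    ((Ideal.span {(p : ℤ)}).primesOver (NumberField.RingOfIntegers K)).ncard = 2 →
      ((p : ℕ) : NumberField.RingOfIntegers K) ∈ 𝔭.asIdeal →
      (∀ (w : NumberField.InfinitePlace K) (k : NumberField.RingOfIntegers K), k ∈ 𝔭.asIdeal ↔ ‖ι.symm (w.embedding (k : K))‖ < 1) →
      ((p : ℕ) : NumberField.RingOfIntegers K) ∈ 𝔭bar.asIdeal → 𝔭bar ≠ 𝔭 →
    (∀ ℓ : ℕ, ℓ.Prime → ℓ ∣ N → ((Ideal.span {(ℓ : ℤ)}).primesOver (NumberField.RingOfIntegers K)).ncard = 2) →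
    IsCoprime (N : ℤ) (NumberField.discr K) → ¬ p ∣ NumberField.classNumber K → ¬ p ∣ Nat.totient N →
    κ.IsAnticyclotomic →
    ∃ (ΩK : ℂ) (Ωp : (unrIntegers p)ˣ) (L : UnrSeries p),
      ΩK ≠ 0 ∧
      CastellaWan2024.IsCWBDPLFunction ι 𝔭 κ γ f (NumberField.discr K) ΩK ((Ωp : unrIntegers p) : PadicComplex p) L ∧
      ∀ (j : ℤ_[p] →+* unrIntegers p),
        (∀ x : ℤ_[p], ((j x : unrIntegers p) : PadicComplex p) = algebraMap ℚ_[p] (PadicComplex p) (x : ℚ_[p])) →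
        Ideal.span {L} ≤ (Castella2018.AcSelmer.XAc.charIdeal (W.baseChange K) p κ 𝔭bar ∅ γ).map (PowerSeries.map j))

/-- **The cell-B side conditions HOW's binders already give** (kernel-checked): from HOW's binders, `3 < N` (modularity: `N = N_E ≥ 11`) and the
GL₂(ℤ_p)-image in LV19's currency (Serre: `ρ̄_{E,p}` onto and `p ≥ 5` ⟹ every `ρ̄_{E,pⁿ}` onto ⟹ every `ℤ_p`-automorphism of `T_pE` is Galois).
[cite: SerreAbelianLadic1968, Ch. IV §3.4 Lemma 3] [cite: LongoVigni2019, Thm. 1.4 (hypothesis (2))] -/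
theorem cellB_side_of_binders (hmodP : ModularForms.nonempty_modularParametrizationData)
    (W : WeierstrassCurve ℚ) [W.IsElliptic] (p : ℕ) [Fact p.Prime] (hp : 5 ≤ p) (hs : Rank1Residual.Surj W p)
    (N : ℕ) (hN : (N : ℤ) = W.conductorNorm ℤ) :
    3 < N ∧ ∀ u : Module.End ℤ_[p] (W.tateModule p), IsUnit u → u ∈ Set.range (W.galoisRepTate p) := by
  refine ⟨?_, fun u hu ↦ ?_⟩
  · have h11 : 11 ≤ W.conductorNorm ℤ := ModularForms.eleven_le_conductorNorm_of_modularity hmodP W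
    have hN' : (W.conductorNorm ℤ : ℕ) = N := by exact_mod_cast hN.symm
    rw [← hN']
    omega
  · exact Summit.BirchSwinnertonDyer.BirchSwinnertonDyer.Theorems.ThreeAdicImageOverK.mem_range_galoisRepTate_of_forall_hasSurjectiveModNGaloisRep
      W p (serre_hasSurjectiveModNGaloisRep_pow_holds W p hp hs) u hu

include hLZ23ThmA in
/-- **HOW on CELL B (kernel glue, no `sorry`) from SHAPE B1**: the text of `Ratlift.stub_howardIntegralSS` with the cell-B binders
`¬ p ∣ NumberField.classNumber K →`, `Squarefree N →`, `¬ p ∣ Nat.totient N →` inserted after `κ₂.IsAnticyclotomic →`, FROM Lei–Zhao 2023 Thm. A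
in HOW's currency (section hypothesis `hLZ23ThmA`, displayed as the first binder): instantiate at `(ι, W, K, v, v̄, κ₂, γ₂, f)`; `3 < N` and the
image hypothesis by `cellB_side_of_binders`.  CONDITIONAL on the displayed shape hypothesis (to be discharged by a Literature typing of the printed
theorem; not by this file).  [cite: LeiZhao2023, Thm. A (arXiv:2211.04377v3 p0003 L30–L49)] -/
theorem howardIntegralSS_cellB_of_lz23ThmA :
    SignedTwoVariableInputs → Literature.NumberTheory.EllipticCurves.ModularForms.nonempty_modularParametrizationData → ∀ (W : WeierstrassCurve ℚ) [W.IsElliptic] [W.IsGloballyMinimal] (p : ℕ) [Fact p.Prime], 5 ≤ p → W.HasGoodReductionAtPrime p → W.frobeniusTrace p = 0 → Literature.NumberTheory.EllipticCurves.Rank1Residual.Surj W p → ∀ (K : Type) [Field K] [NumberField K] (ι : PadicAlgCl p ≃+* ℂ) (v vbar : IsDedekindDomain.HeightOneSpectrum (NumberField.RingOfIntegers K)) (κ₁ κ₂ : Literature.NumberTheory.EllipticCurves.ZpExtension K p) (γ₁ γ₂ : Field.absoluteGaloisGroup K) [Fact (Literature.NumberTheory.EllipticCurves.ZpExtension.IsTopGeneratorPair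 κ₁ κ₂ γ₁ γ₂)] [NeZero (NumberField.discr K).natAbs] (N : ℕ) [NeZero N] (f : CuspForm (CongruenceSubgroup.Gamma0 N) 2), Literature.NumberTheory.EllipticCurves.ModularForms.IsNewformOf W f → (N : ℤ) = W.conductorNorm ℤ → Literature.NumberTheory.EllipticCurves.IsImaginaryQuadratic K → ((Ideal.span {(p : ℤ)}).primesOver (NumberField.RingOfIntegers K)).ncard = 2 → ((p : ℕ) : NumberField.RingOfIntegers K) ∈ v.asIdeal → ((p : ℕ) : NumberField.RingOfIntegers K) ∈ vbar.asIdeal → vbar ≠ v → (∀ (w : NumberField.InfinitePlace K) (k : NumberField.RingOfIntegers K), k ∈ v.asIdeal ↔ ‖ι.symm (w.embedding (k : K))‖ < 1) → IsCoprime (N : ℤ) (NumberField.discr K) → (∀ ℓ : ℕ, ℓ.Prime → ℓ ∣ N → ((Ideal.span {(ℓ : ℤ)}).primesOver (NumberField.RingOfIntegers K)).ncard = 2) → Odd (NumberField.discr K) → NumberField.discr K ≠ -3 → κ₁.IsCyclotomic → κ₂.IsAnticyclotomic → ¬ p ∣ NumberField.classNumber K → Squarefree N → ¬ p ∣ Nat.totient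 N → (haveI : Fact (κ₂.IsTopGenerator γ₂) := ⟨Literature.NumberTheory.EllipticCurves.YanZhu2026.isTopGenerator_of_pair (κ₁ := κ₁) (γ₁ := γ₁)⟩; ∃ (ΩK : ℂ) (Ωp : (Literature.NumberTheory.EllipticCurves.unrIntegers p)ˣ) (L : Literature.NumberTheory.EllipticCurves.UnrSeries p), ΩK ≠ 0 ∧ Literature.NumberTheory.EllipticCurves.IsBDPLFunction ι v κ₂ γ₂ f ΩK ((Ωp : Literature.NumberTheory.EllipticCurves.unrIntegers p) : PadicComplex p) L ∧ ∀ j : ℤ_[p] →+* Literature.NumberTheory.EllipticCurves.unrIntegers p, (∀ x : ℤ_[p], ((j x : Literature.NumberTheory.EllipticCurves.unrIntegers p) : PadicComplex p) = algebraMap ℚ_[p] (PadicComplex p) (x : ℚ_[p])) → L ∈ (Literature.NumberTheory.EllipticCurves.Castella2018.AcSelmer.XAc.charIdeal (W.baseChange K) p κ₂ vbar ∅ γ₂).map (PowerSeries.map j)) := by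
  intro _ hmodP W _ _ p _ hp hgood ha0 hs K _ _ ι v vbar κ₁ κ₂ γ₁ γ₂ _ _ N _ f hf hN hK hsplit hv hvbar hvv hι hcop hHeeg hodd
    hne3 _ hκ₂ hh hsqf hφ
  haveI hγ₂ : Fact (κ₂.IsTopGenerator γ₂) := ⟨YanZhu2026.isTopGenerator_of_pair (κ₁ := κ₁) (γ₁ := γ₁)⟩
  obtain ⟨h3N, hbig⟩ := cellB_side_of_binders hmodP W p hp hs N hN
  exact hLZ23ThmA ι W K v vbar κ₂ γ₂ hf hN h3N hsqf hp hgood ha0 hbig hK hodd hne3 hsplit hv hι hvbar hvv hHeeg hcop hh hφ hκ₂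

include hLZ23ThmACW in
/-- **HOW on CELL B (kernel glue, no `sorry`) from SHAPE B2** (Castella–Wan currency), given BCS25 Prop. 4.2.2 (`h422`, displayed; in the
skeleton it is conjunct (4) of `Ratlift.stub_namedFactsSS`): the shape at `(ι, W, K, v, v̄, κ₂, γ₂, f)` gives a Castella–Wan frame
`(Ω_K^W, Ω_p^W, L_W)` with `(L_W) ⊆ ch·R₀⟦T⟧` along every compatible `j`; `h422` gives SOME Castella-2018 frame `(Ω_K′, Ω_p′, L′)` ((irr_K) from
`Surj`); frame concordance (p634869; `p ∤ N` from good reduction, `p ∤ d_K` from `p` split) gives `(L_W) = (L′)` in `𝓞_{ℂ_p}⟦T⟧`; the descent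
`X11b.unrSeries_mem_span_singleton_of_map_mem` gives `L′ = u·L_W` in `R₀⟦T⟧`; hence `L′ ∈ ch·R₀⟦T⟧` — steps (2)–(5) of cell A's glue verbatim.
CONDITIONAL on the displayed shape hypothesis.  [cite: LeiZhao2023, Thm. A (arXiv:2211.04377v3 p0003 L30–L49)]
[cite: CastellaWan2023, Prop. 2.1 (MS pp. 5–6)] [cite: Castella2018, Thm. 3.1] [cite: BurungaleCastellaSkinner2025, Prop. 4.2.2] -/
theorem howardIntegralSS_cellB_of_lz23ThmACW (h422 : BurungaleCastellaSkinner2025.prop422_exists_isBDPLFunction_mu_eq_zero) :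
    SignedTwoVariableInputs → Literature.NumberTheory.EllipticCurves.ModularForms.nonempty_modularParametrizationData → ∀ (W : WeierstrassCurve ℚ) [W.IsElliptic] [W.IsGloballyMinimal] (p : ℕ) [Fact p.Prime], 5 ≤ p → W.HasGoodReductionAtPrime p → W.frobeniusTrace p = 0 → Literature.NumberTheory.EllipticCurves.Rank1Residual.Surj W p → ∀ (K : Type) [Field K] [NumberField K] (ι : PadicAlgCl p ≃+* ℂ) (v vbar : IsDedekindDomain.HeightOneSpectrum (NumberField.RingOfIntegers K)) (κ₁ κ₂ : Literature.NumberTheory.EllipticCurves.ZpExtension K p) (γ₁ γ₂ : Field.absoluteGaloisGroup K) [Fact (Literature.NumberTheory.EllipticCurves.ZpExtension.IsTopGeneratorPair κ₁ κ₂ γ₁ γ₂)] [NeZero (NumberField.discr K).natAbs] (N : ℕ) [NeZero N] (f : CuspForm (CongruenceSubgroup.Gamma0 N) 2), Literature.NumberTheory.EllipticCurves.ModularForms.IsNewformOf W f → (N : ℤ) = W.conductorNorm ℤ → Literature.NumberTheory.EllipticCurves.IsImaginaryQuadratic K → ((Ideal.span {(p : ℤ)}).primesOver (NumberField.RingOfIntegers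 K)).ncard = 2 → ((p : ℕ) : NumberField.RingOfIntegers K) ∈ v.asIdeal → ((p : ℕ) : NumberField.RingOfIntegers K) ∈ vbar.asIdeal → vbar ≠ v → (∀ (w : NumberField.InfinitePlace K) (k : NumberField.RingOfIntegers K), k ∈ v.asIdeal ↔ ‖ι.symm (w.embedding (k : K))‖ < 1) → IsCoprime (N : ℤ) (NumberField.discr K) → (∀ ℓ : ℕ, ℓ.Prime → ℓ ∣ N → ((Ideal.span {(ℓ : ℤ)}).primesOver (NumberField.RingOfIntegers K)).ncard = 2) → Odd (NumberField.discr K) → NumberField.discr K ≠ -3 → κ₁.IsCyclotomic → κ₂.IsAnticyclotomic → ¬ p ∣ NumberField.classNumber K → Squarefree N → ¬ p ∣ Nat.totient N → (haveI : Fact (κ₂.IsTopGenerator γ₂) := ⟨Literature.NumberTheory.EllipticCurves.YanZhu2026.isTopGenerator_of_pair (κ₁ := κ₁) (γ₁ := γ₁)⟩; ∃ (ΩK : ℂ) (Ωp : (Literature.NumberTheory.EllipticCurves.unrIntegers p)ˣ) (L : Literature.NumberTheory.EllipticCurves.UnrSeries p), ΩK ≠ 0 ∧ Literature.NumberTheory.EllipticCurves.IsBDPLFunction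 ι v κ₂ γ₂ f ΩK ((Ωp : Literature.NumberTheory.EllipticCurves.unrIntegers p) : PadicComplex p) L ∧ ∀ j : ℤ_[p] →+* Literature.NumberTheory.EllipticCurves.unrIntegers p, (∀ x : ℤ_[p], ((j x : Literature.NumberTheory.EllipticCurves.unrIntegers p) : PadicComplex p) = algebraMap ℚ_[p] (PadicComplex p) (x : ℚ_[p])) → L ∈ (Literature.NumberTheory.EllipticCurves.Castella2018.AcSelmer.XAc.charIdeal (W.baseChange K) p κ₂ vbar ∅ γ₂).map (PowerSeries.map j)) := by
  intro _ hmodP W _ _ p _ hp hgood ha0 hs K _ _ ι v vbar κ₁ κ₂ γ₁ γ₂ _ _ N _ f hf hN hK hsplit hv hvbar hvv hι hcop hHeeg hodd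
    hne3 _ hκ₂ hh hsqf hφ
  haveI hγ₂ : Fact (κ₂.IsTopGenerator γ₂) := ⟨YanZhu2026.isTopGenerator_of_pair (κ₁ := κ₁) (γ₁ := γ₁)⟩
  have hprime : p.Prime := Fact.out
  have hp2 : p ≠ 2 := by omega
  have hirr : (W.baseChange K).HasIrreducibleModPGaloisRep p :=
    Summit.BirchSwinnertonDyer.Rank1Residual.irrK_of_surj W p hs K hK.1
  obtain ⟨h3N, hbig⟩ := cellB_side_of_binders hmodP W p hp hs N hN
  -- (1) the Castella–Wan frame of the shape: `(L_W) ⊆ ch·R₀⟦T⟧` along every compatible `j`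
  obtain ⟨ΩKw, Ωpw, LW, hΩKw, hLW, hleW⟩ :=
    hLZ23ThmACW ι W K v vbar κ₂ γ₂ hf hN h3N hsqf hp hgood ha0 hbig hK hodd hne3 hsplit hv hι hvbar hvv hHeeg hcop hh hφ hκ₂
  -- (2) some Castella-2018 frame (BCS25 Prop. 4.2.2; only its `IsBDPLFunction` clause is used)
  obtain ⟨ΩK', Ωp', L', hΩK', hL', -⟩ := h422 ι W K v κ₂ γ₂ hf (by omega) hgood hK hHeeg hsplit hodd hne3 hirr hv
    hι hκ₂ hγ₂.out
  -- (3) frame concordance in `𝓞_{ℂ_p}⟦T⟧`: `(L_W) = (L')`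
  have hN' : (W.conductorNorm ℤ : ℕ) = N := by exact_mod_cast hN.symm
  have hpN : ¬ p ∣ N := by
    rw [← hN']
    exact not_dvd_conductorNorm_of_hasGoodReductionAtPrime W hgood
  have hpD : ¬ (p : ℤ) ∣ NumberField.discr K :=
    not_dvd_discr_of_ncard_primesOver hprime (by rw [hK.1]; exact hsplit)
  have hΩpw : ((Ωpw : unrIntegers p) : ℂ_[p]) ≠ 0 := fun h0 ↦ by
    have h1 := (unrIntegers.isUnit_iff_norm_eq_one (Ωpw : unrIntegers p)).mp Ωpw.isUnit
    rw [h0, norm_zero] at h1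
    exact zero_ne_one h1
  have hΩp' : ((Ωp' : unrIntegers p) : ℂ_[p]) ≠ 0 := fun h0 ↦ by
    have h1 := (unrIntegers.isUnit_iff_norm_eq_one (Ωp' : unrIntegers p)).mp Ωp'.isUnit
    rw [h0, norm_zero] at h1
    exact zero_ne_one h1
  have hconc : Ideal.span {PowerSeries.map (Summit.BirchSwinnertonDyer.Rank1Residual.X11b.R1.unrToCpInt p) LW} =
      Ideal.span {PowerSeries.map (Summit.BirchSwinnertonDyer.Rank1Residual.X11b.R1.unrToCpInt p) L'} :=
    Summit.BirchSwinnertonDyer.BirchSwinnertonDyer.Theorems.SignedBaseChangeAcDivFrameConcordance.span_map_eq_of_isCWBDPLFunction_of_isBDPLFunction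
      hp2 hK hκ₂ hγ₂.out hpN hpD hΩKw hΩK' hΩpw hΩp' hLW hL'
  -- (4) descent to `R₀⟦T⟧`: `L' ∈ (L_W)`, i.e. `L' = u * L_W`
  have hL'mem : L' ∈ Ideal.span ({LW} : Set (UnrSeries p)) :=
    Summit.BirchSwinnertonDyer.Rank1Residual.X11b.unrSeries_mem_span_singleton_of_map_mem (by
      rw [hconc]
      exact Ideal.mem_span_singleton_self _)
  obtain ⟨u, hu⟩ := Ideal.mem_span_singleton'.mp hL'mem
  -- (5) the Castella-2018 frame `(Ω_K', Ω_p', L')` is the witness: `L' = u * L_W ∈ ch·R₀⟦T⟧`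
  refine ⟨ΩK', Ωp', L', hΩK', hL', fun j hj ↦ ?_⟩
  rw [← hu]
  exact Ideal.mul_mem_left _ u (hleW j hj (Ideal.mem_span_singleton_self LW))

include hLZ23ThmA in
/-- SHAPE B1 ⟹ SHAPE B2's membership clause is not needed: B1 alone already gives HOW on cell B (`howardIntegralSS_cellB_of_lz23ThmA`).  Sanity
link in the other direction: SHAPE B1 gives the `(L) ⊆ ch·R₀⟦T⟧` form of its own conclusion (span of a member).
[cite: LeiZhao2023, Thm. A (arXiv:2211.04377v3 p0003 L30–L49)] -/
theorem span_le_of_lz23ThmA {p : ℕ} [Fact p.Prime] (ι : PadicAlgCl p ≃+* ℂ) (W : WeierstrassCurve ℚ) [W.IsElliptic] [W.IsGloballyMinimal]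
    (K : Type) [Field K] [NumberField K] (𝔭 𝔭bar : IsDedekindDomain.HeightOneSpectrum (NumberField.RingOfIntegers K))
    (κ : ZpExtension K p) (γ : Field.absoluteGaloisGroup K) [Fact (κ.IsTopGenerator γ)] {N : ℕ} [NeZero N]
    {f : CuspForm (CongruenceSubgroup.Gamma0 N) 2} (hf : ModularForms.IsNewformOf W f)
    (hN : (N : ℤ) = W.conductorNorm ℤ) (h3N : 3 < N) (hsqf : Squarefree N) (hp : 5 ≤ p) (hgood : W.HasGoodReductionAtPrime p)
    (ha0 : W.frobeniusTrace p = 0) (hbig : ∀ u : Module.End ℤ_[p] (W.tateModule p), IsUnit u → u ∈ Set.range (W.galoisRepTate p))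
    (hK : IsImaginaryQuadratic K) (hodd : Odd (NumberField.discr K)) (hne3 : NumberField.discr K ≠ -3)
    (hsplit : ((Ideal.span {(p : ℤ)}).primesOver (NumberField.RingOfIntegers K)).ncard = 2)
    (h𝔭 : ((p : ℕ) : NumberField.RingOfIntegers K) ∈ 𝔭.asIdeal)
    (hι : ∀ (w : NumberField.InfinitePlace K) (k : NumberField.RingOfIntegers K), k ∈ 𝔭.asIdeal ↔ ‖ι.symm (w.embedding (k : K))‖ < 1)
    (h𝔭bar : ((p : ℕ) : NumberField.RingOfIntegers K) ∈ 𝔭bar.asIdeal) (hne : 𝔭bar ≠ 𝔭)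
    (hHeeg : ∀ ℓ : ℕ, ℓ.Prime → ℓ ∣ N → ((Ideal.span {(ℓ : ℤ)}).primesOver (NumberField.RingOfIntegers K)).ncard = 2)
    (hcop : IsCoprime (N : ℤ) (NumberField.discr K)) (hh : ¬ p ∣ NumberField.classNumber K) (hφ : ¬ p ∣ Nat.totient N)
    (hκ : κ.IsAnticyclotomic) :
    ∃ (ΩK : ℂ) (Ωp : (unrIntegers p)ˣ) (L : UnrSeries p),
      ΩK ≠ 0 ∧
      IsBDPLFunction ι 𝔭 κ γ f ΩK ((Ωp : unrIntegers p) : PadicComplex p) L ∧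
      ∀ (j : ℤ_[p] →+* unrIntegers p),
        (∀ x : ℤ_[p], ((j x : unrIntegers p) : PadicComplex p) = algebraMap ℚ_[p] (PadicComplex p) (x : ℚ_[p])) →
        Ideal.span {L} ≤ (Castella2018.AcSelmer.XAc.charIdeal (W.baseChange K) p κ 𝔭bar ∅ γ).map (PowerSeries.map j) := by
  obtain ⟨ΩK, Ωp, L, hΩK, hL, hmem⟩ :=
    hLZ23ThmA ι W K 𝔭 𝔭bar κ γ hf hN h3N hsqf hp hgood ha0 hbig hK hodd hne3 hsplit h𝔭 hι h𝔭bar hne hHeeg hcop hh hφ hκ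
  exact ⟨ΩK, Ωp, L, hΩK, hL, fun j hj ↦ (Ideal.span_singleton_le_iff_mem _).mpr (hmem j hj)⟩

end CellB

end Summit.BirchSwinnertonDyer.BirchSwinnertonDyer.Cruxes.TwoVariableEulerSystemDivisibility.Ratlift.CellB
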